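import Literature.Geometry.DiscreteGeometry.ThreePointBoundGeneral
import HarnessLib

/-!
# Three-point bounds for energy minimisation (Cohn–Woo 2012, Theorem 3.2)

Cohn–Woo, *Three-point bounds for energy minimization* (J. AMS 25 (2012)), §3, Theorem 3.2
(Theorem 7 of the arXiv version): let `C ⊂ S^{n-1}` be an `N`-point configuration, `N ≥ 3`, and
`f` a pair potential on `[-1, 1)`. If `H(u,v,t) = c + Σ_k ⟨F_k, T_k^n(u,v,t)⟩` with `F_k ⪰ 0`, where
`T_k^n(u,v,t) = (N-2) S_k^n(u,v,t) + S_k^n(u,u,1) + S_k^n(v,v,1) + S_k^n(t,t,1)` is built from the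
Bachoc–Vallentin matrices `S_k^n`, and `H(u,v,t) ≤ (f(u) + f(v) + f(t))/3` on
`D = {-1 ≤ u,v,t < 1, 1 + 2uvt - u² - v² - t² ≥ 0}`, then the `f`-energy of `C` is at least
`N((N-1)c - ⟨F_0, J⟩)` (ordered pairs; Cohn–Woo write `(N/2)((N-1)c - ⟨F_0,J⟩)` for unordered pairs).

We prove the theorem in ABSTRACT form, exactly parallel to
`BachocVallentin.card_le_of_threePoint`: the three-point function `F(u,v,t) = Σ_k ⟨F_k, S_k^n⟩`
enters only through its symmetry and the positivity `Σ_{x,y,z ∈ C} F(x·y, x·z, y·z) ≥ 0`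
(Bachoc–Vallentin's (pos S), proved in the tree for all `n ≥ 3`), and we allow an additional
two-point part `A` with `Σ_{x,y ∈ C} A(x·y) ≥ 0` (for `A = Σ_{k ≥ 1} a_k P_k^n`, `a_k ≥ 0`; Cohn–Woo's
statement is the case `A = 0`):

* `CohnWoo.sum3_distinct_uni` — the coincidence bookkeeping of §3: over ordered triples of
  distinct points, `Σ (φ(x·y) + φ(x·z) + φ(y·z)) = 3 (N-2) Σ_{x ≠ y} φ(x·y)`;
* `CohnWoo.energy_ge_of_threePoint` — **Theorem 3.2**: if
  `c + (N-2) F(u,v,t) + F(u,u,1) + F(v,v,1) + F(t,t,1) + (A(u)+A(v)+A(t))/3 ≤ (f(u)+f(v)+f(t))/3`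
  on `D`, then `Σ_{x ≠ y ∈ C} f(x·y) ≥ N((N-1)c - F(1,1,1) - A(1))`.

Certificates (exact rational SDP solutions; cell `pub-packcert`, energy family E3PT) discharge the
hypothesis by sums-of-squares identities in separate files.

## References
* H. Cohn, J. Woo, *Three-point bounds for energy minimization*, J. Amer. Math. Soc. 25 (2012)
  929–958, §3, Theorems 3.1–3.2. [`CohnWoo2012`]
* C. Bachoc, F. Vallentin, J. Amer. Math. Soc. 21 (2008), §4. [`BachocVallentin2007`]
-/

noncomputable section

open Finset
open scoped RealInnerProductSpace

namespace Literature.Geometry.DiscreteGeometry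

namespace CohnWoo

variable {n : ℕ}

/-- **Coincidence bookkeeping (Cohn–Woo §3, the identity behind `T_k^n`).** For a univariate `φ`,
summing `φ(x·y) + φ(x·z) + φ(y·z)` over ordered triples of distinct points of `C` gives
`3 (|C| - 2) Σ_{x ≠ y} φ(x·y)`. [cite: CohnWoo2012, §3 (eq. (3.1) and the formula for Σ A_{u,u,1} S_k^n(u,u,1))] -/
theorem sum3_distinct_uni [DecidableEq (EuclideanSpace ℝ (Fin n))]
    (C : Finset (EuclideanSpace ℝ (Fin n))) (φ : ℝ → ℝ) :
    (∑ x ∈ C, ∑ y ∈ C.erase x, ∑ z ∈ (C.erase x).erase y,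
        (φ (inner ℝ x y) + φ (inner ℝ x z) + φ (inner ℝ y z)))
      = 3 * ((C.card : ℝ) - 2) * ∑ x ∈ C, ∑ y ∈ C.erase x, φ (inner ℝ x y) := by
  set M : ℝ := (C.card : ℝ) with hM
  set S : ℝ := ∑ x ∈ C, ∑ y ∈ C.erase x, φ (inner ℝ x y) with hS
  have hcard1 : ∀ x ∈ C, ((C.erase x).card : ℝ) = M - 1 := by
    intro x hx
    rw [Finset.card_erase_of_mem hx, Nat.cast_sub (Finset.card_pos.2 ⟨x, hx⟩), hM]; simp
  have hcard2 : ∀ x ∈ C, ∀ y ∈ C.erase x, (((C.erase x).erase y).card : ℝ) = M - 2 := by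
    intro x hx y hy
    have h2 : 2 ≤ C.card := by
      have : (C.erase x).card = C.card - 1 := Finset.card_erase_of_mem hx
      have hp : 0 < (C.erase x).card := Finset.card_pos.2 ⟨y, hy⟩
      omega
    rw [Finset.card_erase_of_mem hy, Finset.card_erase_of_mem hx, Nat.sub_sub,
      Nat.cast_sub h2, hM]
    norm_num
  -- first slot: z-independent
  have e1 : (∑ x ∈ C, ∑ y ∈ C.erase x, ∑ z ∈ (C.erase x).erase y, φ (inner ℝ x y))
      = (M - 2) * S := by
    rw [hS, Finset.mul_sum]
    refine Finset.sum_congr rfl fun x hx => ?_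
    rw [Finset.mul_sum]
    refine Finset.sum_congr rfl fun y hy => ?_
    rw [Finset.sum_const, nsmul_eq_mul, hcard2 x hx y hy]
  -- second slot: remove y from the z-range
  have e2 : (∑ x ∈ C, ∑ y ∈ C.erase x, ∑ z ∈ (C.erase x).erase y, φ (inner ℝ x z))
      = (M - 2) * S := by
    have hx_eq : ∀ x ∈ C, (∑ y ∈ C.erase x, ∑ z ∈ (C.erase x).erase y, φ (inner ℝ x z))
        = (M - 2) * ∑ y ∈ C.erase x, φ (inner ℝ x y) := by
      intro x hx
      have hin : ∀ y ∈ C.erase x, (∑ z ∈ (C.erase x).erase y, φ (inner ℝ x z))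
          = (∑ z ∈ C.erase x, φ (inner ℝ x z)) - φ (inner ℝ x y) := by
        intro y hy
        rw [Finset.sum_erase_eq_sub hy]
      rw [Finset.sum_congr rfl hin, Finset.sum_sub_distrib, Finset.sum_const, nsmul_eq_mul,
        hcard1 x hx]
      ring
    rw [Finset.sum_congr rfl hx_eq, ← Finset.mul_sum]
  -- third slot: exchange the roles of x and y
  have e3 : (∑ x ∈ C, ∑ y ∈ C.erase x, ∑ z ∈ (C.erase x).erase y, φ (inner ℝ y z))
      = (M - 2) * S := by
    set g : EuclideanSpace ℝ (Fin n) → ℝ := fun y => ∑ z ∈ C.erase y, φ (inner ℝ y z) with hg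
    have hin : ∀ x ∈ C, ∀ y ∈ C.erase x, (∑ z ∈ (C.erase x).erase y, φ (inner ℝ y z))
        = g y - φ (inner ℝ x y) := by
      intro x hx y hy
      have hyC : y ∈ C := Finset.mem_of_mem_erase hy
      have hxy : x ≠ y := fun h => (Finset.ne_of_mem_erase hy) h.symm
      have hxCy : x ∈ C.erase y := Finset.mem_erase.2 ⟨hxy, hx⟩
      rw [Finset.erase_right_comm, Finset.sum_erase_eq_sub hxCy, hg, real_inner_comm x y]
    have hx_eq : ∀ x ∈ C, (∑ y ∈ C.erase x, ∑ z ∈ (C.erase x).erase y, φ (inner ℝ y z))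
        = (∑ y ∈ C, g y) - g x - ∑ y ∈ C.erase x, φ (inner ℝ x y) := by
      intro x hx
      rw [Finset.sum_congr rfl (hin x hx), Finset.sum_sub_distrib, Finset.sum_erase_eq_sub hx]
    have hSg : S = ∑ x ∈ C, g x := by rw [hS]
    rw [Finset.sum_congr rfl hx_eq, Finset.sum_sub_distrib, Finset.sum_sub_distrib,
      Finset.sum_const, nsmul_eq_mul, ← hM, ← hSg]
    ring
  have hsplit : (∑ x ∈ C, ∑ y ∈ C.erase x, ∑ z ∈ (C.erase x).erase y,
        (φ (inner ℝ x y) + φ (inner ℝ x z) + φ (inner ℝ y z)))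
      = (∑ x ∈ C, ∑ y ∈ C.erase x, ∑ z ∈ (C.erase x).erase y, φ (inner ℝ x y))
        + (∑ x ∈ C, ∑ y ∈ C.erase x, ∑ z ∈ (C.erase x).erase y, φ (inner ℝ x z))
        + (∑ x ∈ C, ∑ y ∈ C.erase x, ∑ z ∈ (C.erase x).erase y, φ (inner ℝ y z)) := by
    simp only [Finset.sum_add_distrib]
  rw [hsplit, e1, e2, e3]
  ring

/-- **Cohn–Woo 2012, Theorem 3.2 (three-point bound for energy), abstract form with an explicit
two-point part.** Let `C` be a set of `N ≥ 3` unit vectors of `ℝⁿ`, `f` any pair potential,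
`A` with `Σ_{x,y ∈ C} A(x·y) ≥ 0`, `F` symmetric with `Σ_{x,y,z ∈ C} F(x·y,x·z,y·z) ≥ 0`
(e.g. `F = Σ_k ⟨F_k, S_k^n⟩`, `F_k ⪰ 0`, by Bachoc–Vallentin's (pos S)), and `c ∈ ℝ`. If
`c + (N-2) F(u,v,t) + F(u,u,1) + F(v,v,1) + F(t,t,1) + (A(u)+A(v)+A(t))/3 ≤ (f(u)+f(v)+f(t))/3`
for all `-1 ≤ u,v,t < 1` with `1 + 2uvt - u² - v² - t² ≥ 0`, then the `f`-energy of `C` over ordered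
pairs satisfies `Σ_{x ≠ y} f(x·y) ≥ N((N-1)c - F(1,1,1) - A(1))`.
[cite: CohnWoo2012, Theorem 3.2] -/
theorem energy_ge_of_threePoint [DecidableEq (EuclideanSpace ℝ (Fin n))]
    (C : Finset (EuclideanSpace ℝ (Fin n))) (hC : ∀ x ∈ C, ‖x‖ = 1) (hN : 3 ≤ C.card)
    (f : ℝ → ℝ) (A : ℝ → ℝ) (F : ℝ → ℝ → ℝ → ℝ) (c : ℝ)
    (hA : 0 ≤ BachocVallentin.pairSum C A) (hF : 0 ≤ BachocVallentin.tripleSum C F)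
    (hF12 : ∀ u v t, F u v t = F v u t) (hF23 : ∀ u v t, F u v t = F u t v)
    (h : ∀ u v t : ℝ, -1 ≤ u → u < 1 → -1 ≤ v → v < 1 → -1 ≤ t → t < 1 →
      0 ≤ 1 + 2 * u * v * t - u ^ 2 - v ^ 2 - t ^ 2 →
      c + ((C.card : ℝ) - 2) * F u v t + F u u 1 + F v v 1 + F t t 1 + (A u + A v + A t) / 3
        ≤ (f u + f v + f t) / 3) :
    (C.card : ℝ) * (((C.card : ℝ) - 1) * c - F 1 1 1 - A 1)
      ≤ ∑ x ∈ C, ∑ y ∈ C.erase x, f (inner ℝ x y) := by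
  set M : ℝ := (C.card : ℝ) with hM
  have hM3 : (3 : ℝ) ≤ M := by rw [hM]; exact_mod_cast hN
  have hself : ∀ x ∈ C, inner ℝ x x = (1 : ℝ) := fun x hx => by
    rw [real_inner_self_eq_norm_sq, hC x hx]; norm_num
  -- range of inner products of distinct points: [-1, 1)
  have hrange : ∀ x ∈ C, ∀ y ∈ C, x ≠ y → -1 ≤ inner ℝ x y ∧ inner ℝ x y < 1 := by
    intro x hx y hy hxy
    refine ⟨neg_one_le_real_inner_of_norm_eq_one (hC x hx) (hC y hy),
      lt_of_le_of_ne (real_inner_le_one_of_norm_eq_one (hC x hx) (hC y hy)) ?_⟩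
    intro h1
    exact hxy ((inner_eq_one_iff_of_norm_eq_one (𝕜 := ℝ) (hC x hx) (hC y hy)).1 h1)
  have hcard1 : ∀ x ∈ C, ((C.erase x).card : ℝ) = M - 1 := by
    intro x hx
    rw [Finset.card_erase_of_mem hx, Nat.cast_sub (Finset.card_pos.2 ⟨x, hx⟩), hM]; simp
  have hcard2 : ∀ x ∈ C, ∀ y ∈ C.erase x, (((C.erase x).erase y).card : ℝ) = M - 2 := by
    intro x hx y hy
    have h2 : 2 ≤ C.card := by
      have : (C.erase x).card = C.card - 1 := Finset.card_erase_of_mem hx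
      have hp : 0 < (C.erase x).card := Finset.card_pos.2 ⟨y, hy⟩
      omega
    rw [Finset.card_erase_of_mem hy, Finset.card_erase_of_mem hx, Nat.sub_sub,
      Nat.cast_sub h2, hM]
    norm_num
  -- Step a: split the pair sum
  have hpair : BachocVallentin.pairSum C A = M * A 1 + ∑ x ∈ C, ∑ y ∈ C.erase x, A (inner ℝ x y) := by
    unfold BachocVallentin.pairSum
    rw [show M * A 1 = ∑ x ∈ C, A 1 by rw [Finset.sum_const, nsmul_eq_mul, hM],
      ← Finset.sum_add_distrib]
    refine Finset.sum_congr rfl fun x hx => ?_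
    rw [← Finset.add_sum_erase C _ hx, hself x hx]
  -- Step a': split the triple sum
  have htriple : BachocVallentin.tripleSum C F = M * F 1 1 1
      + 3 * ∑ x ∈ C, ∑ y ∈ C.erase x, F (inner ℝ x y) (inner ℝ x y) 1
      + ∑ x ∈ C, ∑ y ∈ C.erase x, ∑ z ∈ (C.erase x).erase y,
          F (inner ℝ x y) (inner ℝ x z) (inner ℝ y z) := by
    unfold BachocVallentin.tripleSum
    have hx_split : ∀ x ∈ C,
        (∑ y ∈ C, ∑ z ∈ C, F (inner ℝ x y) (inner ℝ x z) (inner ℝ y z)) =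
          F 1 1 1 + 3 * ∑ y ∈ C.erase x, F (inner ℝ x y) (inner ℝ x y) 1 +
            ∑ y ∈ C.erase x, ∑ z ∈ (C.erase x).erase y,
              F (inner ℝ x y) (inner ℝ x z) (inner ℝ y z) := by
      intro x hx
      rw [← Finset.add_sum_erase C _ hx]
      have hyx : (∑ z ∈ C, F (inner ℝ x x) (inner ℝ x z) (inner ℝ x z)) =
          F 1 1 1 + ∑ z ∈ C.erase x, F (inner ℝ x z) (inner ℝ x z) 1 := by
        rw [← Finset.add_sum_erase C _ hx, hself x hx]
        congr 1
        refine Finset.sum_congr rfl fun z _ => ?_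
        rw [hF12, hF23]
      have hyne : ∀ y ∈ C.erase x,
          (∑ z ∈ C, F (inner ℝ x y) (inner ℝ x z) (inner ℝ y z)) =
            2 * F (inner ℝ x y) (inner ℝ x y) 1 +
              ∑ z ∈ (C.erase x).erase y, F (inner ℝ x y) (inner ℝ x z) (inner ℝ y z) := by
        intro y hy
        have hyC : y ∈ C := Finset.mem_of_mem_erase hy
        rw [← Finset.add_sum_erase C _ hx, ← Finset.add_sum_erase (C.erase x) _ hy, hself x hx,
          hself y hyC, real_inner_comm x y]
        have e1 : F (inner ℝ x y) 1 (inner ℝ x y) = F (inner ℝ x y) (inner ℝ x y) 1 := by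
          rw [hF23]
        rw [e1]; ring
      rw [hyx, Finset.sum_congr rfl hyne, Finset.sum_add_distrib, ← Finset.mul_sum]
      ring
    rw [Finset.sum_congr rfl hx_split, Finset.sum_add_distrib, Finset.sum_add_distrib,
      Finset.sum_const, nsmul_eq_mul, ← hM, ← Finset.mul_sum]
  -- Step b: sum the hypothesis (×3) over ordered triples of distinct points
  have hpt : ∀ x ∈ C, ∀ y ∈ C.erase x, ∀ z ∈ (C.erase x).erase y,
      3 * c + 3 * ((M - 2) * F (inner ℝ x y) (inner ℝ x z) (inner ℝ y z))
        + 3 * (F (inner ℝ x y) (inner ℝ x y) 1 + F (inner ℝ x z) (inner ℝ x z) 1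
          + F (inner ℝ y z) (inner ℝ y z) 1)
        + (A (inner ℝ x y) + A (inner ℝ x z) + A (inner ℝ y z))
        ≤ f (inner ℝ x y) + f (inner ℝ x z) + f (inner ℝ y z) := by
    intro x hx y hy z hz
    have hyC : y ∈ C := Finset.mem_of_mem_erase hy
    have hxy : x ≠ y := fun h => (Finset.ne_of_mem_erase hy) h.symm
    have hz1 : z ∈ C.erase x := Finset.mem_of_mem_erase hz
    have hzC : z ∈ C := Finset.mem_of_mem_erase hz1
    have hzy : z ≠ y := Finset.ne_of_mem_erase hz
    have hzx : z ≠ x := Finset.ne_of_mem_erase hz1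
    obtain ⟨lo1, hi1⟩ := hrange x hx y hyC hxy
    obtain ⟨lo2, hi2⟩ := hrange x hx z hzC hzx.symm
    obtain ⟨lo3, hi3⟩ := hrange y hyC z hzC hzy.symm
    have h0 := h _ _ _ lo1 hi1 lo2 hi2 lo3 hi3
      (BachocVallentin.gram3_nonneg x y z (hC x hx) (hC y hyC) (hC z hzC))
    linarith
  have hdist := Finset.sum_le_sum fun x hx => Finset.sum_le_sum fun y hy =>
    Finset.sum_le_sum fun z hz => hpt x hx y hy z hz
  -- Step c: evaluate the summed pieces
  have hsplit : (∑ x ∈ C, ∑ y ∈ C.erase x, ∑ z ∈ (C.erase x).erase y,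
      (3 * c + 3 * ((M - 2) * F (inner ℝ x y) (inner ℝ x z) (inner ℝ y z))
        + 3 * (F (inner ℝ x y) (inner ℝ x y) 1 + F (inner ℝ x z) (inner ℝ x z) 1
          + F (inner ℝ y z) (inner ℝ y z) 1)
        + (A (inner ℝ x y) + A (inner ℝ x z) + A (inner ℝ y z))))
      = (∑ x ∈ C, ∑ y ∈ C.erase x, ∑ z ∈ (C.erase x).erase y, 3 * c)
        + (∑ x ∈ C, ∑ y ∈ C.erase x, ∑ z ∈ (C.erase x).erase y,
            3 * ((M - 2) * F (inner ℝ x y) (inner ℝ x z) (inner ℝ y z)))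
        + (∑ x ∈ C, ∑ y ∈ C.erase x, ∑ z ∈ (C.erase x).erase y,
            3 * (F (inner ℝ x y) (inner ℝ x y) 1 + F (inner ℝ x z) (inner ℝ x z) 1
              + F (inner ℝ y z) (inner ℝ y z) 1))
        + (∑ x ∈ C, ∑ y ∈ C.erase x, ∑ z ∈ (C.erase x).erase y,
            (A (inner ℝ x y) + A (inner ℝ x z) + A (inner ℝ y z))) := by
    simp only [Finset.sum_add_distrib]
  have eC : (∑ x ∈ C, ∑ y ∈ C.erase x, ∑ z ∈ (C.erase x).erase y, 3 * c)
      = M * (M - 1) * (M - 2) * (3 * c) := by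
    have hin : ∀ x ∈ C, (∑ y ∈ C.erase x, ∑ z ∈ (C.erase x).erase y, 3 * c)
        = (M - 1) * ((M - 2) * (3 * c)) := by
      intro x hx
      have hin2 : ∀ y ∈ C.erase x, (∑ z ∈ (C.erase x).erase y, 3 * c) = (M - 2) * (3 * c) := by
        intro y hy
        rw [Finset.sum_const, nsmul_eq_mul, hcard2 x hx y hy]
      rw [Finset.sum_congr rfl hin2, Finset.sum_const, nsmul_eq_mul, hcard1 x hx]
    rw [Finset.sum_congr rfl hin, Finset.sum_const, nsmul_eq_mul, ← hM]
    ring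
  have eF : (∑ x ∈ C, ∑ y ∈ C.erase x, ∑ z ∈ (C.erase x).erase y,
        3 * ((M - 2) * F (inner ℝ x y) (inner ℝ x z) (inner ℝ y z)))
      = 3 * (M - 2) * ∑ x ∈ C, ∑ y ∈ C.erase x, ∑ z ∈ (C.erase x).erase y,
          F (inner ℝ x y) (inner ℝ x z) (inner ℝ y z) := by
    simp only [Finset.mul_sum]
    refine Finset.sum_congr rfl fun x _ => Finset.sum_congr rfl fun y _ =>
      Finset.sum_congr rfl fun z _ => ?_
    ring
  have eFF : (∑ x ∈ C, ∑ y ∈ C.erase x, ∑ z ∈ (C.erase x).erase y,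
        3 * (F (inner ℝ x y) (inner ℝ x y) 1 + F (inner ℝ x z) (inner ℝ x z) 1
          + F (inner ℝ y z) (inner ℝ y z) 1))
      = 3 * (3 * (M - 2) * ∑ x ∈ C, ∑ y ∈ C.erase x, F (inner ℝ x y) (inner ℝ x y) 1) := by
    rw [← sum3_distinct_uni C (fun w => F w w 1)]
    simp only [Finset.mul_sum]
  have eA : (∑ x ∈ C, ∑ y ∈ C.erase x, ∑ z ∈ (C.erase x).erase y,
        (A (inner ℝ x y) + A (inner ℝ x z) + A (inner ℝ y z)))
      = 3 * (M - 2) * ∑ x ∈ C, ∑ y ∈ C.erase x, A (inner ℝ x y) :=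
    sum3_distinct_uni C A
  have eP : (∑ x ∈ C, ∑ y ∈ C.erase x, ∑ z ∈ (C.erase x).erase y,
        (f (inner ℝ x y) + f (inner ℝ x z) + f (inner ℝ y z)))
      = 3 * (M - 2) * ∑ x ∈ C, ∑ y ∈ C.erase x, f (inner ℝ x y) :=
    sum3_distinct_uni C f
  -- Step d: combine
  have hM2 : 0 < M - 2 := by linarith
  have hF' : 0 ≤ (M - 2) * BachocVallentin.tripleSum C F := mul_nonneg hM2.le hF
  have hA' : 0 ≤ (M - 2) * BachocVallentin.pairSum C A := mul_nonneg hM2.le hA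
  have key : (M - 2) * (3 * (M * ((M - 1) * c - F 1 1 1 - A 1)))
      ≤ (M - 2) * (3 * ∑ x ∈ C, ∑ y ∈ C.erase x, f (inner ℝ x y)) := by
    rw [hsplit, eC, eF, eFF, eA, eP] at hdist
    rw [htriple] at hF'
    rw [hpair] at hA'
    nlinarith [hdist, hF', hA']
  have key2 := le_of_mul_le_mul_left key hM2
  linarith

end CohnWoo

end Literature.Geometry.DiscreteGeometry
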